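import Mathlib
import Summits.Ventures.HodgeRepro2.T5UnitaryThreeHecke

/-!
# The unitary group as the isometry group of a sesquilinear form, and `K_U` as a lattice stabiliser

Blind cell `pub-hodge-repro2`, seat p8 (gen 13), Tier-5 kernel support.  The inert-place Hecke
package is stated for `formUnitaryGroup J = {g : gᴴ J g = J}` and its hyperspecial subgroup
`K_U = U(J) ∩ GL_n(R)`.  The record's objects are the unitary group `U(V_v)` of a hermitian space
`(V_v, h)` and the stabiliser `K_v` of a self-dual lattice `L_v`.  This file is the linear algebra
that identifies them in a basis of `L_v` (CHECK-N3 §20 rows 2–3, «a reading»):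

* `sesqForm J v w = star v ⬝ᵥ (J *ᵥ w)` — the sesquilinear form with Gram matrix `J`;
  `star_sesqForm` (its hermitian symmetry when `Jᴴ = J`), `sesqForm_mulVec`
  (`⟨M v, M w⟩_J = ⟨v, w⟩_{Mᴴ J M}`), `sesqForm_eq_iff` (a form determines its Gram matrix);
* `mem_formUnitaryGroup_iff_isometry` — **`U(J)` is exactly the group of isometries of
  `⟨·,·⟩_J`** (both directions);
* `stdLattice R = Rⁿ ⊆ Eⁿ`; `mem_range_iff_image_stdLattice` — **`g ∈ GL_n(E)` lies in the image of
  `GL_n(R)` iff `g` maps the standard lattice onto itself**; hence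
  `mem_hyperspecialSubgroup_iff_image_stdLattice` — **`K_U` is the stabiliser of `Rⁿ` in `U(J)`**;
* `dualLattice J L = {v : ⟨v, L⟩_J ⊆ R}`; `mem_dualLattice_stdLattice_iff`;
  `dualLattice_stdLattice_eq_self` — **the standard lattice is self-dual for `⟨·,·⟩_J` when `J`
  and `J⁻¹` are integral** — and its converse `integral_of_dualLattice_stdLattice_eq`;
* `dualLattice_stdLattice_J3` — the record's Gram matrix `antidiag(1, u, 1)` with `u ∈ Rˣ`:
  the standard lattice is self-dual, so `K_U` is the stabiliser of a self-dual lattice.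

What stays a reading: that the record's `(V_v, h)` HAS a basis with Gram matrix `antidiag(1, u, 1)`
(the existence of a self-dual lattice / a hyperbolic pair at an inert place — printed).

README §8(d): uses an L-value-free non-vanishing device: NO.
-/

namespace Summit.Ventures.HodgeRepro2.T5UnitaryGroupIsometry

open Matrix IsLocalization

section Form

variable {E : Type*} [CommRing E] [StarRing E] {ι : Type*} [Fintype ι]

/-- The sesquilinear form `⟨v, w⟩_J := star v ⬝ᵥ (J *ᵥ w) = ∑ i j, star (v i) * J i j * w j` with
Gram matrix `J`. -/
def sesqForm (J : Matrix ι ι E) (v w : ι → E) : E := star v ⬝ᵥ (J *ᵥ w)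

/-- `⟨v, w⟩_J = ∑ i, ∑ j, star (v i) * (J i j * w j)`. -/
theorem sesqForm_apply (J : Matrix ι ι E) (v w : ι → E) :
    sesqForm J v w = ∑ i, ∑ j, star (v i) * (J i j * w j) := by
  simp only [sesqForm, dotProduct, mulVec, Pi.star_apply, Finset.mul_sum]

/-- The form is additive in the second variable. -/
theorem sesqForm_add_right (J : Matrix ι ι E) (v w w' : ι → E) :
    sesqForm J v (w + w') = sesqForm J v w + sesqForm J v w' := by
  simp only [sesqForm, mulVec_add, dotProduct_add]

/-- The form is `E`-linear in the second variable. -/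
theorem sesqForm_smul_right (J : Matrix ι ι E) (v w : ι → E) (c : E) :
    sesqForm J v (c • w) = c * sesqForm J v w := by
  simp only [sesqForm, mulVec_smul, dotProduct_smul, smul_eq_mul]

/-- `⟨M v, M w⟩_J = ⟨v, w⟩_{Mᴴ J M}`. -/
theorem sesqForm_mulVec (J M : Matrix ι ι E) (v w : ι → E) :
    sesqForm J (M *ᵥ v) (M *ᵥ w) = sesqForm (Mᴴ * J * M) v w := by
  simp only [sesqForm, star_mulVec, dotProduct_mulVec, mulVec_mulVec, vecMul_vecMul,
    Matrix.mul_assoc]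

variable [DecidableEq ι]

/-- `⟨e_i, e_j⟩_J = J i j`. -/
theorem sesqForm_single (J : Matrix ι ι E) (i j : ι) :
    sesqForm J (Pi.single i 1) (Pi.single j 1) = J i j := by
  simp only [sesqForm, ← Pi.single_star, star_one, mulVec_single_one, single_dotProduct, one_mul,
    col_apply]

/-- A sesquilinear form determines its Gram matrix. -/
theorem sesqForm_eq_iff (A B : Matrix ι ι E) :
    (∀ v w, sesqForm A v w = sesqForm B v w) ↔ A = B := by
  constructor
  · intro h
    ext i j
    simpa only [sesqForm_single] using h (Pi.single i 1) (Pi.single j 1)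
  · rintro rfl _ _
    rfl

omit [DecidableEq ι] in
/-- `star ⟨v, w⟩_J = ⟨w, v⟩_{Jᴴ}`. -/
theorem star_sesqForm (J : Matrix ι ι E) (v w : ι → E) :
    star (sesqForm J v w) = sesqForm Jᴴ w v := by
  simp only [sesqForm]
  rw [star_dotProduct, star_star, star_mulVec, dotProduct_mulVec]

omit [DecidableEq ι] in
/-- For a hermitian Gram matrix the form is hermitian: `star ⟨v, w⟩_J = ⟨w, v⟩_J`. -/
theorem star_sesqForm_of_isHermitian {J : Matrix ι ι E} (hJ : J.IsHermitian) (v w : ι → E) :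
    star (sesqForm J v w) = sesqForm J w v := by
  rw [star_sesqForm, hJ.eq]

/-- **The unitary group of `J` is the isometry group of `⟨·,·⟩_J`**: `g ∈ U(J)` iff
`⟨g v, g w⟩_J = ⟨v, w⟩_J` for all `v, w`. -/
theorem mem_formUnitaryGroup_iff_isometry (J : Matrix ι ι E) (g : GL ι E) :
    g ∈ T5UnitaryGroupForm.formUnitaryGroup J ↔
      ∀ v w, sesqForm J ((g : Matrix ι ι E) *ᵥ v) ((g : Matrix ι ι E) *ᵥ w) = sesqForm J v w := by
  rw [T5UnitaryGroupForm.mem_formUnitaryGroup_iff]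
  constructor
  · intro h v w
    rw [sesqForm_mulVec, h]
  · intro h
    exact (sesqForm_eq_iff _ _).mp fun v w => by rw [← sesqForm_mulVec, h]

end Form

section Lattice

variable (R : Type*) {E : Type*} [CommRing R] [CommRing E] [Algebra R E] {ι : Type*}

/-- The standard lattice `Rⁿ ⊆ Eⁿ`: the vectors with `R`-integral coordinates. -/
def stdLattice : Set (ι → E) := {v | ∀ i, IsInteger R (v i)}

variable {R}

/-- Membership in the standard lattice: every coordinate is integral. -/
theorem mem_stdLattice_iff (v : ι → E) : v ∈ stdLattice R ↔ ∀ i, IsInteger R (v i) := Iff.rfl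

/-- A finite sum of integral elements is integral. -/
theorem isInteger_sum {s : Finset ι} {f : ι → E} (hf : ∀ i ∈ s, IsInteger R (f i)) :
    IsInteger R (∑ i ∈ s, f i) :=
  Subsemiring.sum_mem _ hf

variable [DecidableEq ι]

/-- The standard basis vectors lie in the standard lattice. -/
theorem single_one_mem_stdLattice (j : ι) : (Pi.single j 1 : ι → E) ∈ stdLattice R := by
  intro i
  by_cases h : i = j
  · subst h
    simp only [Pi.single_eq_same]
    exact isInteger_one
  · simp only [Pi.single_eq_of_ne h]
    exact isInteger_zero

variable [Fintype ι]

omit [DecidableEq ι] in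
/-- An integral matrix maps the standard lattice into itself. -/
theorem mulVec_mem_stdLattice {M : Matrix ι ι E} (hM : ∀ i j, IsInteger R (M i j)) {v : ι → E}
    (hv : v ∈ stdLattice R) : M *ᵥ v ∈ stdLattice R := by
  intro i
  simp only [mulVec, dotProduct]
  exact isInteger_sum fun j _ => isInteger_mul (hM i j) (hv j)

omit [DecidableEq ι] in
/-- An integral matrix maps the standard lattice into itself (row-vector form). -/
theorem vecMul_mem_stdLattice {M : Matrix ι ι E} (hM : ∀ i j, IsInteger R (M i j)) {v : ι → E}
    (hv : v ∈ stdLattice R) : v ᵥ* M ∈ stdLattice R := by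
  intro j
  simp only [vecMul, dotProduct]
  exact isInteger_sum fun i _ => isInteger_mul (hv i) (hM i j)

/-- The entries of a matrix in the image of `GL_n(R)` are integral. -/
theorem isInteger_apply_of_mem_range {g : GL ι E}
    (hg : g ∈ (Matrix.GeneralLinearGroup.map (algebraMap R E)).range) (i j : ι) :
    IsInteger R ((g : Matrix ι ι E) i j) := by
  obtain ⟨g₀, rfl⟩ := hg
  exact ⟨g₀.val i j, rfl⟩

/-- The entries of the inverse of a matrix in the image of `GL_n(R)` are integral. -/
theorem isInteger_inv_apply_of_mem_range {g : GL ι E}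
    (hg : g ∈ (Matrix.GeneralLinearGroup.map (algebraMap R E)).range) (i j : ι) :
    IsInteger R ((g⁻¹ : GL ι E) i j) :=
  isInteger_apply_of_mem_range (Subgroup.inv_mem _ hg) i j

/-- A matrix whose columns lie in the standard lattice is integral. -/
theorem isInteger_apply_of_forall_col {M : Matrix ι ι E}
    (h : ∀ j, M *ᵥ Pi.single j 1 ∈ stdLattice R) (i j : ι) : IsInteger R (M i j) := by
  simpa only [mulVec_single_one, col_apply] using h j i

end Lattice

section LatticeField

variable {R E : Type*} [CommRing R] [Field E] [Algebra R E] [IsFractionRing R E] {ι : Type*}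
  [Fintype ι] [DecidableEq ι]

/-- **`g ∈ GL_n(E)` lies in the image of `GL_n(R)` iff it maps the standard lattice onto
itself** (`K_v = U(V_v) ∩ GL_n(𝒪_v)` is the stabiliser of the lattice `𝒪_vⁿ`). -/
theorem mem_range_iff_image_stdLattice (g : GL ι E) :
    g ∈ (Matrix.GeneralLinearGroup.map (algebraMap R E)).range ↔
      (fun v => (g : Matrix ι ι E) *ᵥ v) '' stdLattice R = stdLattice R := by
  constructor
  · intro hg
    apply Set.Subset.antisymm
    · rintro _ ⟨v, hv, rfl⟩
      exact mulVec_mem_stdLattice (isInteger_apply_of_mem_range hg) hv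
    · intro v hv
      refine ⟨(g⁻¹ : GL ι E) *ᵥ v, mulVec_mem_stdLattice (isInteger_inv_apply_of_mem_range hg) hv, ?_⟩
      simp only [mulVec_mulVec, Units.mul_inv, one_mulVec]
  · intro h
    apply T5UnitaryThreeCorner.mem_range_of_integral
    · refine isInteger_apply_of_forall_col fun j => ?_
      rw [← h]
      exact ⟨Pi.single j 1, single_one_mem_stdLattice j, rfl⟩
    · refine isInteger_apply_of_forall_col fun j => ?_
      have hj : (Pi.single j 1 : ι → E) ∈ (fun v => (g : Matrix ι ι E) *ᵥ v) '' stdLattice R := by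
        rw [h]
        exact single_one_mem_stdLattice j
      obtain ⟨v, hv, hgv⟩ := hj
      have : (g⁻¹ : GL ι E) *ᵥ (Pi.single j 1 : ι → E) = v := by
        rw [← hgv, mulVec_mulVec, Units.inv_mul, one_mulVec]
      rw [this]
      exact hv

variable [StarRing E]

/-- **`K_U` is the stabiliser of the standard lattice in `U(J)`.** -/
theorem mem_hyperspecialSubgroup_iff_image_stdLattice (J : Matrix ι ι E)
    (g : T5UnitaryGroupForm.formUnitaryGroup J) :
    g ∈ T5UnitaryHeckeAdjoint.hyperspecialSubgroup R J ↔
      (fun v => ((g : GL ι E) : Matrix ι ι E) *ᵥ v) '' stdLattice R = stdLattice R := by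
  exact Iff.trans Subgroup.mem_subgroupOf (mem_range_iff_image_stdLattice (g : GL ι E))

end LatticeField

section Dual

variable (R : Type*) {E : Type*} [CommRing R] [CommRing E] [StarRing E] [Algebra R E] {ι : Type*}
  [Fintype ι]

/-- The dual lattice of `L` for `⟨·,·⟩_J`: the vectors `v` with `⟨v, w⟩_J` integral for all
`w ∈ L`. -/
def dualLattice (J : Matrix ι ι E) (L : Set (ι → E)) : Set (ι → E) :=
  {v | ∀ w ∈ L, IsInteger R (sesqForm J v w)}

variable {R}

/-- Membership in the dual lattice: `⟨v, w⟩_J` is integral for every `w ∈ L`. -/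
theorem mem_dualLattice_iff (J : Matrix ι ι E) (L : Set (ι → E)) (v : ι → E) :
    v ∈ dualLattice R J L ↔ ∀ w ∈ L, IsInteger R (sesqForm J v w) := Iff.rfl

variable [DecidableEq ι]

/-- `v` is in the dual of the standard lattice iff the row vector `star v ᵥ* J` is integral. -/
theorem mem_dualLattice_stdLattice_iff (J : Matrix ι ι E) (v : ι → E) :
    v ∈ dualLattice R J (stdLattice R) ↔ star v ᵥ* J ∈ stdLattice R := by
  constructor
  · intro h j
    have := h (Pi.single j 1) (single_one_mem_stdLattice j)
    simp only [sesqForm, mulVec_single_one] at this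
    exact this
  · intro h w hw
    rw [sesqForm, dotProduct_mulVec]
    exact isInteger_sum fun j _ => isInteger_mul (h j) (hw j)

omit [Fintype ι] [DecidableEq ι] in
/-- When the star preserves integrality, `star v` is integral iff `v` is. -/
theorem star_mem_stdLattice_iff (hstar : ∀ x : E, IsInteger R x → IsInteger R (star x))
    (v : ι → E) : star v ∈ stdLattice R ↔ v ∈ stdLattice R := by
  constructor
  · intro h i
    simpa only [Pi.star_apply, star_star] using hstar _ (h i)
  · intro h i
    exact hstar _ (h i)

/-- **The standard lattice is self-dual for `⟨·,·⟩_J` when `J` and `J⁻¹` are integral** (and the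
star preserves integrality). -/
theorem dualLattice_stdLattice_eq_self (hstar : ∀ x : E, IsInteger R x → IsInteger R (star x))
    {J J' : Matrix ι ι E} (hJJ' : J * J' = 1) (hJ : ∀ i j, IsInteger R (J i j))
    (hJ' : ∀ i j, IsInteger R (J' i j)) : dualLattice R J (stdLattice R) = stdLattice R := by
  ext v
  rw [mem_dualLattice_stdLattice_iff, ← star_mem_stdLattice_iff hstar v]
  constructor
  · intro h
    have := vecMul_mem_stdLattice hJ' h
    rwa [vecMul_vecMul, hJJ', vecMul_one] at this
  · intro h
    exact vecMul_mem_stdLattice hJ h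

/-- The converse: if the standard lattice is self-dual for `⟨·,·⟩_J` then `J` and its inverse `J'`
(`J' * J = 1`) are integral. -/
theorem integral_of_dualLattice_stdLattice_eq
    (hstar : ∀ x : E, IsInteger R x → IsInteger R (star x)) {J J' : Matrix ι ι E}
    (hJ'J : J' * J = 1) (h : dualLattice R J (stdLattice R) = stdLattice R) :
    (∀ i j, IsInteger R (J i j)) ∧ ∀ i j, IsInteger R (J' i j) := by
  constructor
  · intro i j
    have hi : (Pi.single i 1 : ι → E) ∈ dualLattice R J (stdLattice R) := by
      rw [h]
      exact single_one_mem_stdLattice i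
    rw [mem_dualLattice_stdLattice_iff, ← Pi.single_star, star_one, single_one_vecMul] at hi
    simpa only [row_apply] using hi j
  · intro i j
    set w : ι → E := star (Pi.single i 1 ᵥ* J') with hw
    have hw' : w ∈ dualLattice R J (stdLattice R) := by
      rw [mem_dualLattice_stdLattice_iff, hw, star_star, vecMul_vecMul, hJ'J, vecMul_one]
      exact single_one_mem_stdLattice i
    rw [h, ← star_mem_stdLattice_iff hstar, hw, star_star, single_one_vecMul] at hw'
    simpa only [row_apply] using hw' j

omit [StarRing E] in
/-- The record's Gram matrix `antidiag(1, u, 1)` with `u ∈ Rˣ` is integral. -/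
theorem isInteger_J3 {u : E} (hu : IsInteger R u) (i j : Fin 3) :
    IsInteger R (T5HermitianThreeElements.J3 u i j) := by
  rw [T5HermitianThreeElements.J3_eq]
  fin_cases i <;> fin_cases j <;>
    simp only [Matrix.of_apply, Matrix.cons_val', Matrix.cons_val_zero, Matrix.cons_val_one,
      Matrix.cons_val_two, Matrix.head_cons, Matrix.tail_cons, Matrix.empty_val',
      Matrix.cons_val_fin_one, Fin.zero_eta, Fin.mk_one, Fin.reduceFinMk] <;>
    first | exact isInteger_zero | exact isInteger_one | exact hu

end Dual

section DualField

variable {R E : Type*} [CommRing R] [Field E] [StarRing E] [Algebra R E]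

/-- **The standard lattice is self-dual for the record's form `antidiag(1, u, 1)`**, `u` a unit of
`R`: so `K_U` (the stabiliser of the standard lattice in `U(J3 u)`) is the stabiliser of a
self-dual lattice. -/
theorem dualLattice_stdLattice_J3
    (hstar : ∀ x : E, IsInteger R x → IsInteger R (star x)) {u : E} (hu0 : u ≠ 0)
    (hu : IsInteger R u) (hu' : IsInteger R u⁻¹) :
    dualLattice R (T5HermitianThreeElements.J3 u) (stdLattice R) = stdLattice R := by
  refine dualLattice_stdLattice_eq_self hstar (J' := T5HermitianThreeElements.J3 u⁻¹) ?_
    (isInteger_J3 hu) (isInteger_J3 hu')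
  rw [T5HermitianThreeElements.J3_eq, T5HermitianThreeElements.J3_eq]
  exact T5HermitianThreeElements.J3_mul_J3inv u hu0

end DualField

end Summit.Ventures.HodgeRepro2.T5UnitaryGroupIsometry
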